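import Mathlib
import Summits.ValiantsHypothesis.ValiantsHypothesis.Theses.PrincipalMinorColouring
import Literature.Computability.AlgebraicComplexity.ReadKDeterminantalRepresentationsProofs

/-!
# Line `closure_counting` — crux `PrincipalMinorColouring.BorderBoundedRankTwo` (stmt-ValiantsHypothesis-21038)

T6 rung r = 2 of `BorderBoundedRank` (stmt-3778; tenure sweep TABLE row 35): for large `n`, for every colouring `κ` of the
`R` slots with classes of size `≤ 2`, the coefficient vector of `per_n(x+J)` is not even in the CLOSURE of the coefficient
vectors of `n!·det(I_R + diag(x∘κ)·K)`, `K ∈ ℂ^{R×R}`.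

Mechanism (tenure g4 line hint A4.2, made closure-robust): the EXACT case (RankTwoImpossible ✓, stmt-3782) is the dictionary
"principal-minor representation ↦ read-2 symbolic determinantal representation of size 1+2R" (Schur complement,
`exists_isSymbDetRepr_isReadK_of_pmRepr`) followed by Hrubeš–Joglekar 2025 Cor. 8 (PROVED in the tree,
`HrubesJoglekar2025_readK_perPoly_holds`). HJ25's counting is a statement about the IMAGE of a fixed polynomial map — and
images pass to closures: (1) for fixed `(R, κ)` the symbolic pattern is fixed and only the constants `K` move, so every
linear operation HJ25 applies to `per_n = det M` (undo the shift `x ↦ y-1`, substitute constants outside `k` well-placed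
variables `Z`, read off the `2^k` multilinear `Z`-coefficients) is a CONTINUOUS linear map on the finite-dimensional space of
polynomials of degree `≤ max(R, n)` and can be applied to the limit; (2) by HJ25 Lemma 1 (`exists_det_eq_const_mul_det_normalForm`)
each approximant's `Z`-coefficient vector lies in the image `NFImage k` of the fixed normal-form map
`(a, H) ↦ coeffs(a·det(diag(X_ι, 0) + H))` with `≤ 1 + (4k)²` parameters (`s ≤ 2k` slots since classes have size `≤ 2`);
(3) universality of `per_n` (`exists_subst_perPoly_eq`, tree theorem, `n ≥ |V k|`) makes EVERY vector of `ℂ^{2^k}` such a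
limit, so `NFImage k` is dense; (4) a finite union of polynomial images with fewer than `2^k` parameters is contained in a
proper hypersurface (`exists_aeval_eq_zero_of_card_lt`), which is closed and nowhere dense — contradiction for `k = 11`
(`2^11 = 2048 > 1937 = 1 + 44²`), `n ≥ |V 11| ≤ 2^14`.

* `stub_transport` (M–L, Lean plumbing: product topology on coefficient functions restricted to bounded degree, Schur
  complement as in the exact dictionary, normal form, renaming `Z ≃ Fin k`): border membership ⇒ every substitution value of
  `per_n` on `Z` lies in `closure (NFImage k)`.
* `stub_denseCount` (M): `closure (NFImage k) = everything ⇒ 2^k ≤ 1 + (4k)²`.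
* `BorderBoundedRankTwo_of`: composition with the tree's universality theorem, `k = 11`, `n₀ = |V 11|` (kernel-checked).

Calibration (honest): PROVABLE NOW — the rung is a corollary of HJ25 (in tree) + elementary topology; it is NOT open and
NOT ≥ any open bound (for growing r the same argument gives border-read-r impossibility for r ≤ c√n/log n, exactly HJ25's
range). The same two stubs with `2` replaced by `r` (`s ≤ r·k`, `k = k(r)`) give `BorderBoundedRank` (3778) for every
fixed r. VP ≠ VNP is not moved.
-/

noncomputable section

set_option linter.dupNamespace false

namespace Summit.ValiantsHypothesis.ValiantsHypothesis.Cruxes.BorderBoundedRankTwo.ClosureCounting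

open MvPolynomial Matrix
open Literature.Computability.AlgebraicComplexity
open Summit.ValiantsHypothesis.ValiantsHypothesis.Theses.PrincipalMinorColouring

/-- The multilinear monomial `∏_{i : r i} X_i` on `k` abstract variables, as an exponent vector. -/
def monB {k : ℕ} (r : Fin k → Bool) : Fin k →₀ ℕ :=
  ∑ i ∈ Finset.univ.filter (fun i => r i = true), Finsupp.single i 1

/-- The normal-form coefficient map of Hrubeš–Joglekar's Lemma 1 with `s` variable slots filled according to `ι`:
`(a, H) ↦ (r ↦ coeff_{monB r} (a · det (diag(X_{ι 1}, …, X_{ι s}, 0, …, 0) + H)))`. -/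
def nfMap (k s : ℕ) (ι : Fin s → Fin k) (p : ℂ × Matrix (Fin s ⊕ Fin s) (Fin s ⊕ Fin s) ℂ) : (Fin k → Bool) → ℂ :=
  fun r => coeff (monB r) (C p.1 * (diagonal (Sum.elim (fun q => (X (ι q) : MvPolynomial (Fin k) ℂ)) 0) +
    p.2.map (fun a : ℂ => (C a : MvPolynomial (Fin k) ℂ))).det)

/-- The union of the normal-form images over all slot patterns with at most `2k` slots (classes of size `≤ 2`). -/
def NFImage (k : ℕ) : Set ((Fin k → Bool) → ℂ) :=
  ⋃ (s : Fin (2 * k + 1)), ⋃ (ι : Fin (s : ℕ) → Fin k), Set.range (nfMap k s ι)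

/-- **Stub 1 (M–L) — closure transport to the normal-form image.** If the coefficient vector of `per_n(x+J)` is in the
closure of the coefficient vectors of `n!·det(I_R + diag(x∘κ)K)` (classes of `κ` of size `≤ 2`), then for every injective
placement `ζ` of `k` variables and every substitution `S` of constants outside `ζ`, the `2^k` coefficients `c` of
`S(per_n) = Σ_h c_h ∏_{h i} X_{ζ i}` lie in `closure (NFImage k)`. [cite: HrubesJoglekar2025, Lemma 1 (p. 53:3)] -/
theorem stub_transport :
    ∀ (n R : ℕ) (κ : Fin R → Fin n × Fin n), (∀ e, (Finset.univ.filter (fun i => κ i = e)).card ≤ 2) →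
      (fun m : (Fin n × Fin n) →₀ ℕ => MvPolynomial.coeff m (MvPolynomial.aeval (fun e => MvPolynomial.X e + 1)
          (Literature.Computability.AlgebraicComplexity.perPoly (Fin n) ℂ))) ∈
        closure (Set.range (fun K : Matrix (Fin R) (Fin R) ℂ => fun m : (Fin n × Fin n) →₀ ℕ =>
          MvPolynomial.coeff m (MvPolynomial.C (n.factorial : ℂ) * (1 + Matrix.diagonal (fun i => MvPolynomial.X (κ i)) *
            K.map (fun a : ℂ => (MvPolynomial.C a : MvPolynomial (Fin n × Fin n) ℂ))).det))) →
      ∀ (k : ℕ) (ζ : Fin k → Fin n × Fin n), Function.Injective ζ →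
      ∀ (S : Fin n × Fin n → MvPolynomial (Fin n × Fin n) ℂ) (c : (Fin k → Bool) → ℂ),
        (∀ i, S (ζ i) = X (ζ i)) → (∀ e, (∀ i, ζ i ≠ e) → ∃ a, S e = C a) →
        aeval S (perPoly (Fin n) ℂ) = ∑ h : Fin k → Bool, C (c h) * ∏ i, (if h i then X (ζ i) else 1) →
        c ∈ closure (NFImage k) := by
  sorry

/-- **Stub 2 (M) — dense-image counting.** A finite union of images of polynomial maps with at most `1 + (4k)²` parameters
whose closure is all of `ℂ^{2^k}` forces `2^k ≤ 1 + (4k)²` (algebraic dependence `exists_aeval_eq_zero_of_card_lt` gives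
a nonzero polynomial vanishing on each image; the product vanishes on the closure of the union; `MvPolynomial.funext`).
[cite: HrubesJoglekar2025, Thm. 2 (p. 53:4)] -/
theorem stub_denseCount :
    ∀ k : ℕ, (∀ c : (Fin k → Bool) → ℂ, c ∈ closure (NFImage k)) → 2 ^ k ≤ 1 + (2 * (2 * k)) ^ 2 := by
  sorry

/-- **Composition (kernel-checked).** `k = 11`, `n₀ = |V 11|`; universality from the tree (`exists_subst_perPoly_eq`).
[cite: HrubesJoglekar2025, Cor. 8 (p. 53:6)] -/
theorem BorderBoundedRankTwo_of : BorderBoundedRankTwo := by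
  refine ⟨Fintype.card (ReadOnceTree.V 11) + 11, fun n hn R κ hκ hv => ?_⟩
  have hVn : Fintype.card (ReadOnceTree.V 11) ≤ n := by omega
  have h11 : 11 ≤ n := by omega
  set ζ : Fin 11 → Fin n × Fin n := fun i => (Fin.castLE h11 i, Fin.castLE h11 i) with hζ
  have hr : Function.Injective fun i => (ζ i).1 := fun i j h => Fin.castLE_injective h11 (by simpa [hζ] using h)
  have hc : Function.Injective fun i => (ζ i).2 := fun i j h => Fin.castLE_injective h11 (by simpa [hζ] using h)
  have hζinj : Function.Injective ζ := fun i j h => hr (congrArg Prod.fst h)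
  have hF : ringChar ℂ ≠ 2 := by rw [ringChar.eq_zero]; norm_num
  have hall : ∀ c : (Fin 11 → Bool) → ℂ, c ∈ closure (NFImage 11) := by
    intro c
    obtain ⟨S, hS1, hS2, hS3⟩ := exists_subst_perPoly_eq hF hVn ζ hr hc c
    exact stub_transport n R κ hκ hv 11 ζ hζinj S c hS1 hS2 hS3
  have h := stub_denseCount 11 hall
  norm_num at h

end Summit.ValiantsHypothesis.ValiantsHypothesis.Cruxes.BorderBoundedRankTwo.ClosureCounting
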